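import Summits.BirchSwinnertonDyer.BirchSwinnertonDyer.Theses.PrintX11a
import Summits.BirchSwinnertonDyer.BirchSwinnertonDyer.Theorems.PrintX11aUpperNonSurjThreeEngineWithoutGZK
import HarnessLib

/-!
# Route `PrintX11a`, child crux U3 = `PrintX11a.UpperNonSurjThree` (item stmt-BirchSwinnertonDyer-20613): **the crux BY NAME
# from NINE print-exact published named facts** — sorry-free, CONDITIONAL
# (cell `bsd-print-x11a`, width seat `bsd-line-x11a-p2` g3 of line «finemu3»; `--supports stmt-BirchSwinnertonDyer-20613`)

HONEST FRAMING.  BSD is not proved by any of this; nothing is asserted about any curve.  Two theorems, no definition, no named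
fact minted, no `sorry`.  CONDITIONAL: the hypotheses are nine statement-only named PUBLISHED facts — Stein–Wuthrich 2013
Thm. 6.1 at a split ∕ non-split multiplicative prime (`hJs`, `hJn`; Schneider–Perrin-Riou–Jones), the exceptional-zero formula
(`hGS`; Greenberg–Stevens 1993, Kobayashi 2006 Cor. 4.2 for odd `p`), Kato 2004 Thm. 12.4 (`h12`), the Modularity theorem
"Version `L`" (`hnf`, `exists_isNewformOf`), Kato §17.13 CONSTRUCTION facts in their print-exact contragredient form V′ ∕ VI′ ∕ XI′
(`hns'`, `hsp'`, `hfine'`; flag `Kato-1713-dual-action`, print-exact per ARM-P; NOT conjuncts of item 19949 today) and Mazur 1978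
Cor. 4.1 (`hMz`, the Manin constant at odd `p` with `p² ∤ N`).  The item 20613 does NOT close by this file (its own signature is
not proved); the gate records a `conditional-result`.  Compare the lead's p617007 `upperNonSurjThree_of_katoTwinFactsFiveAn`
(K2's 23-conjunct bundle `KatoTwinFactsFiveAn` ⟹ U3), of which this is the sharpening in the currency of named facts:
fourteen of the bundle's conjuncts are not needed, three (Kato (12.2.1), `hasEntireLFunction_rat`,
`nonempty_modularParametrizationData`) are theorems of the tree, and three more that p617007 reads — Gross–Zagier–Kolyvagin,
Greenberg 1999 Thm. 1.5, Wuthrich 2014 Cor. 18 — are REDUNDANT at these pairs (this lineage's p619657 ∕ p621238 ∕ p622037 ∕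
p622718: Cor. 18 at the pair from irreducibility + Mazur; `Λ`-torsion of `X(E/ℚ_∞)` from Kato 12.4 + V′ ∕ VI′ at a non-zero
`L`; `rank E(ℚ) = 0` and `#Ш[p^∞] < ∞` from the divisibility by the tree's control theorem and SW 6.1 clause 2).

WHAT.  `upperNonSurjThree_of_nineFacts : hJs → hJn → hGS → h12 → hnf → hns' → hsp' → hfine' → hMz → UpperNonSurjThree` —
at every X11a pair with `ρ̄_{E,3}` not surjective (`3 ∥ N`, images `3Ns` ∕ `3Nn`), `ord₃ #Ш(E) ≤ ord₃ #Ш(E)_an`.  It is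
`Rank1Residual.ClassX11a.upperNonSurjThree_body_of_nineFacts` (p622718) read against the route decl: the μ-road of line
«finemu3» — Greenberg's analytic `μ₃ = 0` at a multiplicative `3` for irreducible `E[3]` (width seat g2's THEOREM
`MultThreeMuAn.muAnZeroAt_three_of_mult_of_irr`, mod Mazur) ⟹ Kato μ-transfer on XI′ ⟹ typed divisibility (Kato 12.4 + V′ ∕ VI′)
⟹ rank-`0` engine without GZK (SW 6.1, Greenberg–Stevens at a split `3`).  beyond-print theorem: the μ₃ input only (as in
p617007); this file adds no mathematics.

FOR THE PLANNER.  A U3 input item `I := hJs ∧ hJn ∧ hGS ∧ h12 ∧ hnf ∧ hns' ∧ hsp' ∧ hfine' ∧ hMz` (nine conjuncts, each a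
`def … : Prop` of `Literature/`) makes the glue `I → UpperNonSurjThree` the one-liner `upperNonSurjThree_of_nineFacts_glue`
below (after `obtain ⟨…⟩`); the γ-keyed road through 19949 keeps p617007.

References: [SteinWuthrich2013] Thm. 6.1 (p. 20); [Kobayashi2006DocMath] Cor. 4.2 (p. 575); [Kato2004Asterisque] Thm. 12.4
(p. 221), §17.13 (pp. 279–280); [Mazur1978] Cor. 4.1; [GreenbergLNM1716] §1 Conj. 1.11, Lemma 3.1; [DiamondShurman2005] Thm. 8.8.3;
tree `Theorems/PrintX11aUpperNonSurjThree{BodyOfContraFacts,Corollary18OfMazur,RankZeroNoGZK,EngineWithoutGZK}.lean`.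
-/

set_option linter.dupNamespace false
set_option autoImplicit false

noncomputable section

open scoped Classical MatrixGroups ModularForm

open WeierstrassCurve
  Literature.NumberTheory.EllipticCurves
  Literature.NumberTheory.EllipticCurves.ModularForms
  Literature.NumberTheory.EllipticCurves.SteinWuthrich2013
  Literature.NumberTheory.EllipticCurves.Kato2004
  Summit.BirchSwinnertonDyer.BirchSwinnertonDyer

namespace Summit.BirchSwinnertonDyer.BirchSwinnertonDyer.Theorems

/-- **Crux U3 `PrintX11a.UpperNonSurjThree` from NINE print-exact published named facts** (sorry-free, CONDITIONAL; closes nothing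
by itself): at every X11a pair with `ρ̄_{E,3}` not surjective, `ord₃ #Ш(E) ≤ ord₃ #Ш(E)_an`, granted Stein–Wuthrich 6.1 ×2,
Greenberg–Stevens ∕ Kobayashi, Kato 12.4, modularity, Kato §17.13 V′ ∕ VI′ ∕ XI′ and Mazur Cor. 4.1 — the route decl by name, read
off `Rank1Residual.ClassX11a.upperNonSurjThree_body_of_nineFacts`. [cite: SteinWuthrich2013, Thm. 6.1 (p. 20)]
[cite: Kobayashi2006DocMath, Cor. 4.2 (p. 575)] [cite: Kato2004Asterisque, Thm. 12.4 (p. 221) and §17.13 (pp. 279–280)]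
[cite: Mazur1978, Cor. 4.1] [cite: GreenbergLNM1716, §1 Conj. 1.11 (p. 62)] -/
theorem upperNonSurjThree_of_nineFacts
    (hJs : thm61_splitMultiplicative) (hJn : thm61_nonsplitMultiplicative)
    (hGS : ∀ (W : WeierstrassCurve ℚ) [W.IsElliptic] [W.IsGloballyMinimal] (p : ℕ) [Fact p.Prime],
      greenberg_stevens (W := W) (p := p))
    (h12 : Kato2004.thm12_4) (hnf : exists_isNewformOf)
    (hns' : Kato2004.exists_multDivisibilityInputs_nonsplit_contra)
    (hsp' : Kato2004.exists_multDivisibilityInputs_split_contra)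
    (hfine' : Kato2004.exists_multDivisibilityInputs_fine_contra) (hMz : mazur_not_dvd_maninConstant_of_odd) :
    Theses.PrintX11a.UpperNonSurjThree :=
  Rank1Residual.ClassX11a.upperNonSurjThree_body_of_nineFacts hJs hJn hGS h12 hnf hns' hsp' hfine' hMz

/-- **The same in glue shape**: the nine-fact conjunction implies `UpperNonSurjThree` (what a planner's U3 input item would be
glued by). [cite: SteinWuthrich2013, Thm. 6.1 (p. 20)] [cite: Kato2004Asterisque, §17.13 (pp. 279–280)] [cite: Mazur1978, Cor. 4.1] -/
theorem upperNonSurjThree_of_nineFacts_glue :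
    (thm61_splitMultiplicative ∧ thm61_nonsplitMultiplicative ∧
      (∀ (W : WeierstrassCurve ℚ) [W.IsElliptic] [W.IsGloballyMinimal] (p : ℕ) [Fact p.Prime],
        greenberg_stevens (W := W) (p := p)) ∧
      Kato2004.thm12_4 ∧ exists_isNewformOf ∧ Kato2004.exists_multDivisibilityInputs_nonsplit_contra ∧
      Kato2004.exists_multDivisibilityInputs_split_contra ∧ Kato2004.exists_multDivisibilityInputs_fine_contra ∧
      mazur_not_dvd_maninConstant_of_odd) →
    Theses.PrintX11a.UpperNonSurjThree :=
  fun ⟨hJs, hJn, hGS, h12, hnf, hns', hsp', hfine', hMz⟩ ↦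
    upperNonSurjThree_of_nineFacts hJs hJn hGS h12 hnf hns' hsp' hfine' hMz

/-! ### Appendix (width seat `bsd-line-x11a-p2` g4, 2026-08-28): the same glue keyed on Greenberg–Stevens at ODD primes ∕
### at `p = 3` only — the PRINTED scope

The nine-fact bundle above — like conjunct 14 of item 19949 `KatoTwinFactsFiveAn` — carries the exceptional-zero formula as
`∀ W p, greenberg_stevens (W := W) (p := p)`, i.e. INCLUDING the instance `p = 2`, for which the docstring of
`Literature.NumberTheory.EllipticCurves.greenberg_stevens` records that NO printed proof has been located (Greenberg–Stevens
1993: `p ≥ 5`; Kobayashi 2006 Cor. 4.2: odd `p`; at `p = 2` every tree consumer takes it as the OPEN conjecture leaf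
`MultUpperHalvesAtTwo.GreenbergStevensAtSplitTwo`).  A U3 input item filed with that conjunct would therefore contain an open
statement.  U3 itself reads the formula ONLY at a split multiplicative `3` (the per-pair theorem
`Rank1Residual.ClassX11a.missingUpperBoundAt_three_of_not_surj_of_nineFacts` takes
`hGS : W.HasSplitMultiplicativeReductionAtPrime 3 → greenberg_stevens (W := W) (p := 3)`).  The theorems below re-key the glue
on the printed scope: `…_oddGS` ∕ `…_oddGS_glue` on "GS at every ODD prime" (Kobayashi's Cor. 4.2 verbatim; the currency
shared with U5 ∕ the K2 corner, `p ≥ 5`), `…_gsAtThree` ∕ `…_gsAtThree_glue` on "GS at a split `3`" (the minimal instance set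
of U3).  Each is WEAKER in hypothesis than `upperNonSurjThree_of_nineFacts_glue` (projection lemmas
`oddGS_of_allGS`, `gsAtThree_of_oddGS`), so the registered r5 stub `stub_nineFactsAn` still implies them; nothing else
changes (same eight other facts, same proof term).  CONDITIONAL; closes nothing by itself; BSD is not proved by any of this. -/

/-- Projection: GS at every prime (the shape of conjunct 14 of item 19949 and of `stub_nineFactsAn`) ⟹ GS at every ODD prime.
[cite: Kobayashi2006DocMath, Cor. 4.2 (p. 575)] -/
theorem oddGS_of_allGS
    (hGS : ∀ (W : WeierstrassCurve ℚ) [W.IsElliptic] [W.IsGloballyMinimal] (p : ℕ) [Fact p.Prime],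
      greenberg_stevens (W := W) (p := p)) :
    ∀ (W : WeierstrassCurve ℚ) [W.IsElliptic] [W.IsGloballyMinimal] (p : ℕ) [Fact p.Prime],
      p ≠ 2 → greenberg_stevens (W := W) (p := p) :=
  fun W _ _ p _ _ ↦ hGS W p

/-- Projection: GS at every odd prime ⟹ GS at a split multiplicative `3` (the only instances U3 reads).
[cite: Kobayashi2006DocMath, Cor. 4.2 (p. 575)] -/
theorem gsAtThree_of_oddGS
    (hGS : ∀ (W : WeierstrassCurve ℚ) [W.IsElliptic] [W.IsGloballyMinimal] (p : ℕ) [Fact p.Prime],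
      p ≠ 2 → greenberg_stevens (W := W) (p := p)) :
    ∀ (W : WeierstrassCurve ℚ) [W.IsElliptic] [W.IsGloballyMinimal],
      W.HasSplitMultiplicativeReductionAtPrime 3 → greenberg_stevens (W := W) (p := 3) :=
  fun W _ _ _ ↦ hGS W 3 (by decide)

/-- **Crux U3 from the nine print-exact facts with Greenberg–Stevens keyed at ODD primes only** (sorry-free, CONDITIONAL;
closes nothing by itself): as `upperNonSurjThree_of_nineFacts`, but the exceptional-zero hypothesis is
`∀ W p, p ≠ 2 → greenberg_stevens` — Kobayashi 2006 Cor. 4.2 as printed (odd `p`), without the unprinted `p = 2` instance.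
[cite: Kobayashi2006DocMath, Cor. 4.2 (p. 575)] [cite: SteinWuthrich2013, Thm. 6.1 (p. 20)]
[cite: Kato2004Asterisque, Thm. 12.4 (p. 221) and §17.13 (pp. 279–280)] [cite: Mazur1978, Cor. 4.1] -/
theorem upperNonSurjThree_of_nineFacts_oddGS
    (hJs : thm61_splitMultiplicative) (hJn : thm61_nonsplitMultiplicative)
    (hGS : ∀ (W : WeierstrassCurve ℚ) [W.IsElliptic] [W.IsGloballyMinimal] (p : ℕ) [Fact p.Prime],
      p ≠ 2 → greenberg_stevens (W := W) (p := p))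
    (h12 : Kato2004.thm12_4) (hnf : exists_isNewformOf)
    (hns' : Kato2004.exists_multDivisibilityInputs_nonsplit_contra)
    (hsp' : Kato2004.exists_multDivisibilityInputs_split_contra)
    (hfine' : Kato2004.exists_multDivisibilityInputs_fine_contra) (hMz : mazur_not_dvd_maninConstant_of_odd) :
    Theses.PrintX11a.UpperNonSurjThree := by
  intro W _ _ p _ hX hns hp3
  subst hp3
  exact Rank1Residual.ClassX11a.missingUpperBoundAt_three_of_not_surj_of_nineFacts hJs hJn h12 hnf hns' hsp' hfine' hMz W
    (gsAtThree_of_oddGS hGS W) hX hns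

/-- **Glue shape, GS at odd primes**: the nine-fact conjunction with its third conjunct read `∀ W p, p ≠ 2 → greenberg_stevens`
implies `UpperNonSurjThree` (what a U3 input item keyed on the printed scope would be glued by).
[cite: Kobayashi2006DocMath, Cor. 4.2 (p. 575)] [cite: Kato2004Asterisque, §17.13 (pp. 279–280)] -/
theorem upperNonSurjThree_of_nineFacts_oddGS_glue :
    (thm61_splitMultiplicative ∧ thm61_nonsplitMultiplicative ∧
      (∀ (W : WeierstrassCurve ℚ) [W.IsElliptic] [W.IsGloballyMinimal] (p : ℕ) [Fact p.Prime],
        p ≠ 2 → greenberg_stevens (W := W) (p := p)) ∧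
      Kato2004.thm12_4 ∧ exists_isNewformOf ∧ Kato2004.exists_multDivisibilityInputs_nonsplit_contra ∧
      Kato2004.exists_multDivisibilityInputs_split_contra ∧ Kato2004.exists_multDivisibilityInputs_fine_contra ∧
      mazur_not_dvd_maninConstant_of_odd) →
    Theses.PrintX11a.UpperNonSurjThree :=
  fun ⟨hJs, hJn, hGS, h12, hnf, hns', hsp', hfine', hMz⟩ ↦
    upperNonSurjThree_of_nineFacts_oddGS hJs hJn hGS h12 hnf hns' hsp' hfine' hMz

/-- **Crux U3 from the nine print-exact facts with Greenberg–Stevens at a split `3` only** (sorry-free, CONDITIONAL; closes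
nothing by itself): the minimal instance set — `∀ W, W` split multiplicative at `3 → greenberg_stevens (W := W) (p := 3)`
(Kobayashi 2006 Cor. 4.2 at `p = 3`).  [cite: Kobayashi2006DocMath, Cor. 4.2 (p. 575)] [cite: SteinWuthrich2013, Thm. 6.1 (p. 20)]
[cite: Kato2004Asterisque, Thm. 12.4 (p. 221) and §17.13 (pp. 279–280)] [cite: Mazur1978, Cor. 4.1] -/
theorem upperNonSurjThree_of_nineFacts_gsAtThree
    (hJs : thm61_splitMultiplicative) (hJn : thm61_nonsplitMultiplicative)
    (hGS3 : ∀ (W : WeierstrassCurve ℚ) [W.IsElliptic] [W.IsGloballyMinimal],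
      W.HasSplitMultiplicativeReductionAtPrime 3 → greenberg_stevens (W := W) (p := 3))
    (h12 : Kato2004.thm12_4) (hnf : exists_isNewformOf)
    (hns' : Kato2004.exists_multDivisibilityInputs_nonsplit_contra)
    (hsp' : Kato2004.exists_multDivisibilityInputs_split_contra)
    (hfine' : Kato2004.exists_multDivisibilityInputs_fine_contra) (hMz : mazur_not_dvd_maninConstant_of_odd) :
    Theses.PrintX11a.UpperNonSurjThree := by
  intro W _ _ p _ hX hns hp3
  subst hp3
  exact Rank1Residual.ClassX11a.missingUpperBoundAt_three_of_not_surj_of_nineFacts hJs hJn h12 hnf hns' hsp' hfine' hMz W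
    (hGS3 W) hX hns

/-- **Glue shape, GS at a split `3`**: the nine-fact conjunction with its third conjunct read
`∀ W, W` split multiplicative at `3 → greenberg_stevens (W := W) (p := 3)` implies `UpperNonSurjThree`.
[cite: Kobayashi2006DocMath, Cor. 4.2 (p. 575)] [cite: Kato2004Asterisque, §17.13 (pp. 279–280)] -/
theorem upperNonSurjThree_of_nineFacts_gsAtThree_glue :
    (thm61_splitMultiplicative ∧ thm61_nonsplitMultiplicative ∧
      (∀ (W : WeierstrassCurve ℚ) [W.IsElliptic] [W.IsGloballyMinimal],
        W.HasSplitMultiplicativeReductionAtPrime 3 → greenberg_stevens (W := W) (p := 3)) ∧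
      Kato2004.thm12_4 ∧ exists_isNewformOf ∧ Kato2004.exists_multDivisibilityInputs_nonsplit_contra ∧
      Kato2004.exists_multDivisibilityInputs_split_contra ∧ Kato2004.exists_multDivisibilityInputs_fine_contra ∧
      mazur_not_dvd_maninConstant_of_odd) →
    Theses.PrintX11a.UpperNonSurjThree :=
  fun ⟨hJs, hJn, hGS3, h12, hnf, hns', hsp', hfine', hMz⟩ ↦
    upperNonSurjThree_of_nineFacts_gsAtThree hJs hJn hGS3 h12 hnf hns' hsp' hfine' hMz

/-- **The registered r5 stub text implies the odd-keyed conjunction** (drop the `p = 2` instance of GS): so the line's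
`stub_nineFactsAn` — and any input item filed with its text — still closes U3 through the odd-keyed glue, and a planner may
file the WEAKER odd-keyed text instead without touching the composition. [cite: Kobayashi2006DocMath, Cor. 4.2 (p. 575)] -/
theorem nineFactsOddGS_of_nineFactsAn
    (h : thm61_splitMultiplicative ∧ thm61_nonsplitMultiplicative ∧
      (∀ (W : WeierstrassCurve ℚ) [W.IsElliptic] [W.IsGloballyMinimal] (p : ℕ) [Fact p.Prime],
        greenberg_stevens (W := W) (p := p)) ∧
      Kato2004.thm12_4 ∧ exists_isNewformOf ∧ Kato2004.exists_multDivisibilityInputs_nonsplit_contra ∧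
      Kato2004.exists_multDivisibilityInputs_split_contra ∧ Kato2004.exists_multDivisibilityInputs_fine_contra ∧
      mazur_not_dvd_maninConstant_of_odd) :
    thm61_splitMultiplicative ∧ thm61_nonsplitMultiplicative ∧
      (∀ (W : WeierstrassCurve ℚ) [W.IsElliptic] [W.IsGloballyMinimal] (p : ℕ) [Fact p.Prime],
        p ≠ 2 → greenberg_stevens (W := W) (p := p)) ∧
      Kato2004.thm12_4 ∧ exists_isNewformOf ∧ Kato2004.exists_multDivisibilityInputs_nonsplit_contra ∧
      Kato2004.exists_multDivisibilityInputs_split_contra ∧ Kato2004.exists_multDivisibilityInputs_fine_contra ∧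
      mazur_not_dvd_maninConstant_of_odd :=
  let ⟨hJs, hJn, hGS, h12, hnf, hns', hsp', hfine', hMz⟩ := h
  ⟨hJs, hJn, oddGS_of_allGS hGS, h12, hnf, hns', hsp', hfine', hMz⟩

/-- **U3 from the registered r5 stub text, routed through the odd-keyed glue** (same statement as
`upperNonSurjThree_of_nineFacts_glue`, proof through `nineFactsOddGS_of_nineFactsAn`): the kernel record that re-keying GS on
odd primes costs the composition nothing. CONDITIONAL; closes nothing by itself. [cite: Kobayashi2006DocMath, Cor. 4.2 (p. 575)] -/
theorem upperNonSurjThree_of_nineFactsAn_via_oddGS :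
    (thm61_splitMultiplicative ∧ thm61_nonsplitMultiplicative ∧
      (∀ (W : WeierstrassCurve ℚ) [W.IsElliptic] [W.IsGloballyMinimal] (p : ℕ) [Fact p.Prime],
        greenberg_stevens (W := W) (p := p)) ∧
      Kato2004.thm12_4 ∧ exists_isNewformOf ∧ Kato2004.exists_multDivisibilityInputs_nonsplit_contra ∧
      Kato2004.exists_multDivisibilityInputs_split_contra ∧ Kato2004.exists_multDivisibilityInputs_fine_contra ∧
      mazur_not_dvd_maninConstant_of_odd) →
    Theses.PrintX11a.UpperNonSurjThree :=
  fun h ↦ upperNonSurjThree_of_nineFacts_oddGS_glue (nineFactsOddGS_of_nineFactsAn h)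

end Summit.BirchSwinnertonDyer.BirchSwinnertonDyer.Theorems

end
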